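import Mathlib
import Summits.QuantumFields.YangMills.Theorems.TransportFieldFanoVacuumElectricEnergy
import HarnessLib

/-!
# The WEIGHTED temporal-plaquette mean of the exact vacuum, up to a logarithm:
# `∫∫ w(U)Ω(U)K_β(U,V)Ω(V)(2 − Re tr U_ℓV_ℓ⁻¹) ≤ (2/β)·λ₀·E[wΩ²]·(6 + ½log W − log c_L + ½ log(1/E[wΩ²]))`
# for EVERY physical weight `0 ≤ w ≤ W`, every link `ℓ`, `β ≥ 1` (route `TransportFieldFano`, ⟨stmt-QuantumFields-23362⟩ helper lane)

This is the planner's open shared lemma `weightedTemporalPlaquette_le` of LINE g17-A (memo `bc/g17-A/memo-TKC-ALD-shared-lemma.md`; stub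
`stub_dWeightedPlaquetteMean` of ⟨23362⟩ = the instance `w = d_x`, stub 3 of ⟨23354⟩ = the instance `w = |r_x|²`) UP TO THE FACTOR
`log(1/E[wΩ²])`: conditionally on a non-negative one-slice weight `w(U)` (bounded, gauge- and twist-invariant), the temporal plaquette at a fixed
link `ℓ` still averages `O((log W + L³ log L + log(1/E[wΩ²]))/β)` in the vacuum pair measure.  NO Harnack inequality for `Ω` along the link is
needed: the memo's «only genuinely open piece» dissolves into a GLOBAL free-energy comparison —
* §1 the single-link half-coupling kernel `E_β^{(ℓ)}` (`= E_β` with the factor of the link `ℓ` at coupling `β/2`): row and column sums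
  `c_{β/2}·c_β^{|E|−1}` (`integral_latEHalf_snd/_fst`), and the tilt identity `e^{(β/2)(2 − Re tr U_ℓV_ℓ⁻¹)}·K_β ≤ e^{β}·E_β^{(ℓ)}`
  (`exp_linkTilt_mul_transferKernel_le`);
* §2 ★★★ `weighted_link_plaquette_le_log` — tangent-line Jensen (✓`integral_mul_le_mul_log`) on the WEIGHTED pair measure
  `w̃ = w(U)Ω(U)K_β(U,V)Ω(V)` (mass `λ₀E[wΩ²]`, ✓`integral_pair_mul_fst_eq`) with the single-link tilt; the tilted mass is bounded by the
  weighted AM–GM `w(U)Ω(U)Ω(V) ≤ ½(t w²Ω(U)² + Ω(V)²/t)` at `t = (W·E[wΩ²])^{−1/2}` and the row/column sums, against the β-uniform floor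
  `c_L c_β^{|E|} ≤ λ₀` (✓`levelValue_zero_ge_uniform`) and the one-link ratio `log c_β − log c_{β/2} ≥ β − 6` (✓`log_linkC_sub_log_linkC_half_ge`):
  `log(M/T̃) ≤ 6 + ½ log W − log c_L + ½ log(1/E[wΩ²])`;
CONSEQUENCE (the symmetrised weight `w(U)+w(V)` of the stub and the sign-free form are spelled out in the sequel `…WeightedPlaquetteStub`):
`stub_dWeightedPlaquetteMean` holds as soon as
`log(1/E[d_xΩ²]) ≤ C_ε β^ε L^k` — an EXPONENTIALLY weak torelon floor `E_Ω[4 − (Re tr P_x)²] ≥ exp(−C_ε β^ε L^k)` — instead of the Harnack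
comparison; the polynomial floor of `…VacuumEnergyBudget` is superseded.
HONEST FRAMING: fixed-lattice helper estimates (`--supports 23362`); the stub itself (the residual floor) and the crux remain OPEN; nothing about
infinite volume, the continuum or the Yang–Mills mass gap.  No `sorry`, no new definition.
References: [cite: ReedSimonIV1978, Thm. XIII.1 and XIII.43]; [cite: Luscher1983, §2–3]; [cite: SeilerLNP1982, §3].
-/

set_option autoImplicit false

noncomputable section

open MeasureTheory Filter Topology Real
open Literature.MathematicalPhysics.QuantumFieldTheory (GaugeConfig Site Edge Plaquette gaugeTransform wilsonAction haarProbability)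
open Literature.MathematicalPhysics.QuantumLattice (fundamentalRep_apply secondCountableTopology_su2)

namespace Summit.QuantumFields.YangMills.Theorems.TransportFieldFano

open Summit.QuantumFields.YangMills.Theorems.FemtoTransferGap
open Summit.QuantumFields.YangMills.Theorems.AdjointLoopFano

variable {L : ℕ} [NeZero L]

/-! ## §1 The single-link half-coupling kernel `E_β^{(ℓ)}` and its row sums -/

/-- Row sum of the single-link half-coupling electric kernel: `∫ ∏ₑ w_{βₑ}(UₑVₑ⁻¹) dV = c_{β/2}·c_β^{|E|−1}` (`β_ℓ = β/2`, `βₑ = β` else).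
[cite: SeilerLNP1982, §3] -/
theorem integral_latEHalf_snd (β : ℝ) (ℓ : Edge 3 L) (U : GaugeConfig 3 L SU2) :
    ∫ V, ∏ e : Edge 3 L, Function.update (fun _ : Edge 3 L => linkW β) ℓ (linkW (β / 2)) e (U e * (V e)⁻¹) ∂configMeasure SU2 L =
      linkC (β / 2) * linkC β ^ (Fintype.card (Edge 3 L) - 1) := by
  classical
  unfold configMeasure
  rw [show (∫ V, ∏ e, Function.update (fun _ : Edge 3 L => linkW β) ℓ (linkW (β / 2)) e (U e * (V e)⁻¹)
      ∂Measure.pi fun _ : Edge 3 L => haarProbability SU2) =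
      ∏ e : Edge 3 L, ∫ v, Function.update (fun _ : Edge 3 L => linkW β) ℓ (linkW (β / 2)) e (U e * v⁻¹) ∂haarProbability SU2 from
    integral_fintype_prod_eq_prod (fun e v => Function.update (fun _ : Edge 3 L => linkW β) ℓ (linkW (β / 2)) e (U e * v⁻¹))]
  rw [Finset.prod_congr rfl fun e _ =>
    integral_comp_mul_inv_left (Function.update (fun _ : Edge 3 L => linkW β) ℓ (linkW (β / 2)) e) (U e)]
  have hupd : (fun e : Edge 3 L => ∫ v, Function.update (fun _ : Edge 3 L => linkW β) ℓ (linkW (β / 2)) e v ∂haarProbability SU2) =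
      Function.update (fun _ : Edge 3 L => linkC β) ℓ (linkC (β / 2)) := by
    funext e
    by_cases h : e = ℓ
    · subst h; simp only [Function.update_self]; rfl
    · simp only [Function.update_of_ne h]; rfl
  rw [show (∏ e : Edge 3 L, ∫ v, Function.update (fun _ : Edge 3 L => linkW β) ℓ (linkW (β / 2)) e v ∂haarProbability SU2) =
      ∏ e : Edge 3 L, Function.update (fun _ : Edge 3 L => linkC β) ℓ (linkC (β / 2)) e from by rw [hupd]]
  rw [Finset.prod_update_of_mem (Finset.mem_univ ℓ), Finset.prod_const]
  congr 2
  rw [Finset.card_univ_sdiff, Finset.card_singleton]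

/-- Column sum of the single-link half-coupling electric kernel: `∫ ∏ₑ w_{βₑ}(UₑVₑ⁻¹) dU = c_{β/2}·c_β^{|E|−1}`. [cite: SeilerLNP1982, §3] -/
theorem integral_latEHalf_fst (β : ℝ) (ℓ : Edge 3 L) (V : GaugeConfig 3 L SU2) :
    ∫ U, ∏ e : Edge 3 L, Function.update (fun _ : Edge 3 L => linkW β) ℓ (linkW (β / 2)) e (U e * (V e)⁻¹) ∂configMeasure SU2 L =
      linkC (β / 2) * linkC β ^ (Fintype.card (Edge 3 L) - 1) := by
  classical
  unfold configMeasure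
  rw [show (∫ U, ∏ e, Function.update (fun _ : Edge 3 L => linkW β) ℓ (linkW (β / 2)) e (U e * (V e)⁻¹)
      ∂Measure.pi fun _ : Edge 3 L => haarProbability SU2) =
      ∏ e : Edge 3 L, ∫ u, Function.update (fun _ : Edge 3 L => linkW β) ℓ (linkW (β / 2)) e (u * (V e)⁻¹) ∂haarProbability SU2 from
    integral_fintype_prod_eq_prod (fun e u => Function.update (fun _ : Edge 3 L => linkW β) ℓ (linkW (β / 2)) e (u * (V e)⁻¹))]
  rw [Finset.prod_congr rfl fun e _ =>
    integral_comp_mul_inv_right (Function.update (fun _ : Edge 3 L => linkW β) ℓ (linkW (β / 2)) e) (V e)]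
  have hupd : (fun e : Edge 3 L => ∫ u, Function.update (fun _ : Edge 3 L => linkW β) ℓ (linkW (β / 2)) e u ∂haarProbability SU2) =
      Function.update (fun _ : Edge 3 L => linkC β) ℓ (linkC (β / 2)) := by
    funext e
    by_cases h : e = ℓ
    · subst h; simp only [Function.update_self]; rfl
    · simp only [Function.update_of_ne h]; rfl
  rw [show (∏ e : Edge 3 L, ∫ u, Function.update (fun _ : Edge 3 L => linkW β) ℓ (linkW (β / 2)) e u ∂haarProbability SU2) =
      ∏ e : Edge 3 L, Function.update (fun _ : Edge 3 L => linkC β) ℓ (linkC (β / 2)) e from by rw [hupd]]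
  rw [Finset.prod_update_of_mem (Finset.mem_univ ℓ), Finset.prod_const]
  congr 2
  rw [Finset.card_univ_sdiff, Finset.card_singleton]

/-- The single-link half-coupling kernel is positive, bounded by `e^{2β|E|}`, and measurable (`β ≥ 0`). [folklore] -/
theorem latEHalf_pos_le_measurable {β : ℝ} (hβ : 0 ≤ β) (ℓ : Edge 3 L) :
    (∀ p : GaugeConfig 3 L SU2 × GaugeConfig 3 L SU2,
        0 < ∏ e : Edge 3 L, Function.update (fun _ : Edge 3 L => linkW β) ℓ (linkW (β / 2)) e (p.1 e * (p.2 e)⁻¹)) ∧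
      (∀ p : GaugeConfig 3 L SU2 × GaugeConfig 3 L SU2,
        ∏ e : Edge 3 L, Function.update (fun _ : Edge 3 L => linkW β) ℓ (linkW (β / 2)) e (p.1 e * (p.2 e)⁻¹) ≤
          Real.exp (2 * β) ^ Fintype.card (Edge 3 L)) ∧
      Measurable fun p : GaugeConfig 3 L SU2 × GaugeConfig 3 L SU2 =>
        ∏ e : Edge 3 L, Function.update (fun _ : Edge 3 L => linkW β) ℓ (linkW (β / 2)) e (p.1 e * (p.2 e)⁻¹) := by
  haveI : SecondCountableTopology SU2 := secondCountableTopology_su2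
  have hfe : ∀ e : Edge 3 L, (∀ W : SU2, 0 < Function.update (fun _ : Edge 3 L => linkW β) ℓ (linkW (β / 2)) e W) ∧
      (∀ W : SU2, Function.update (fun _ : Edge 3 L => linkW β) ℓ (linkW (β / 2)) e W ≤ Real.exp (2 * β)) ∧
      Continuous (Function.update (fun _ : Edge 3 L => linkW β) ℓ (linkW (β / 2)) e) := by
    intro e
    by_cases h : e = ℓ
    · subst h
      simp only [Function.update_self]
      refine ⟨fun W => linkW_pos _ W, fun W => (linkW_le (by positivity) W).trans (Real.exp_le_exp.2 (by linarith)),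
        continuous_linkW _⟩
    · simp only [Function.update_of_ne h]
      exact ⟨fun W => linkW_pos _ W, fun W => linkW_le hβ W, continuous_linkW _⟩
  refine ⟨fun p => Finset.prod_pos fun e _ => (hfe e).1 _, fun p => ?_, ?_⟩
  · calc ∏ e : Edge 3 L, Function.update (fun _ : Edge 3 L => linkW β) ℓ (linkW (β / 2)) e (p.1 e * (p.2 e)⁻¹)
        ≤ ∏ _e : Edge 3 L, Real.exp (2 * β) := Finset.prod_le_prod (fun e _ => ((hfe e).1 _).le) fun e _ => (hfe e).2.1 _
      _ = Real.exp (2 * β) ^ Fintype.card (Edge 3 L) := by rw [Finset.prod_const, Finset.card_univ]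
  · refine (continuous_finsetProd _ fun e _ => (hfe e).2.2.comp ?_).measurable
    exact ((continuous_apply e).comp continuous_fst).mul ((continuous_apply e).comp continuous_snd).inv

/-- **Single-link tilt**: `e^{(β/2)(2 − Re tr U_ℓV_ℓ⁻¹)} K_β(U,V) ≤ e^{β} E_β^{(ℓ)}(U,V)` (`β ≥ 0`; the link `ℓ` passes to half coupling and
the magnetic Boltzmann factor `≤ 1` is dropped). [cite: SeilerLNP1982, §3] -/
theorem exp_linkTilt_mul_transferKernel_le {β : ℝ} (hβ : 0 ≤ β) (ℓ : Edge 3 L) (U V : GaugeConfig 3 L SU2) :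
    Real.exp (β / 2 * (2 - ((((U ℓ * (V ℓ)⁻¹ : SU2) : Matrix (Fin 2) (Fin 2) ℂ)).trace).re)) * transferKernel su2Rep β U V ≤
      Real.exp β * ∏ e : Edge 3 L, Function.update (fun _ : Edge 3 L => linkW β) ℓ (linkW (β / 2)) e (U e * (V e)⁻¹) := by
  classical
  have hK := transferKernel_le_latE hβ U V
  have hX0 : 0 < Real.exp (β / 2 * (2 - ((((U ℓ * (V ℓ)⁻¹ : SU2) : Matrix (Fin 2) (Fin 2) ℂ)).trace).re)) := Real.exp_pos _
  refine (mul_le_mul_of_nonneg_left hK hX0.le).trans (le_of_eq ?_)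
  -- `e^X · ∏ w_β = e^β · ∏ (w_β, ℓ ↦ w_{β/2})`
  unfold latE
  rw [← Finset.mul_prod_erase Finset.univ (fun e => linkW β (U e * (V e)⁻¹)) (Finset.mem_univ ℓ),
    ← Finset.mul_prod_erase Finset.univ
      (fun e => Function.update (fun _ : Edge 3 L => linkW β) ℓ (linkW (β / 2)) e (U e * (V e)⁻¹)) (Finset.mem_univ ℓ)]
  have hrest : ∏ e ∈ Finset.univ.erase ℓ, Function.update (fun _ : Edge 3 L => linkW β) ℓ (linkW (β / 2)) e (U e * (V e)⁻¹) =
      ∏ e ∈ Finset.univ.erase ℓ, linkW β (U e * (V e)⁻¹) :=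
    Finset.prod_congr rfl fun e he => by rw [Function.update_of_ne (Finset.ne_of_mem_erase he)]
  rw [hrest, Function.update_self]
  unfold linkW
  rw [← mul_assoc, ← Real.exp_add, ← mul_assoc, ← Real.exp_add]
  congr 2
  ring

/-! ## §2 ★★★ The weighted temporal plaquette, up to a logarithm -/

set_option maxHeartbeats 800000 in
/-- ★★★ **WEIGHTED TEMPORAL PLAQUETTE OF THE VACUUM, up to a logarithm** (`β ≥ 1`; `Ω ≥ 0` physical, `‖Ω‖ = 1`, `K_βΩ = λ₀Ω`; a weight
`0 ≤ w ≤ W` with `wΩ` physical and `E[wΩ²] = ∫ wΩ² > 0`; any link `ℓ`):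
`∫∫ w(U)Ω(U)K_β(U,V)Ω(V)(2 − Re tr U_ℓV_ℓ⁻¹) ≤ (2/β)·λ₀·E[wΩ²]·(6 + ½ log W − log uniformFloorConst L + ½ log(1/E[wΩ²]))`.
Tangent-line Jensen on the weighted pair measure with the single-link tilt at half coupling; weighted AM–GM at `t = (W E[wΩ²])^{−1/2}`;
row/column sums `c_{β/2}c_β^{|E|−1}`; β-uniform floor; one-link ratio. [cite: Luscher1983, §2–3] [cite: ReedSimonIV1978, Thm. XIII.1] -/
theorem weighted_link_plaquette_le_log {β : ℝ} (hβ : 1 ≤ β) {Ω : GaugeConfig 3 L SU2 → ℝ} (hΩ : IsPhys Ω)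
    (hΩnn : ∀ U, 0 ≤ Ω U) (hn : l2 Ω Ω = 1) (heig : transferApply β Ω = topValue su2Rep L β • Ω)
    {w : GaugeConfig 3 L SU2 → ℝ} (hwΩ : IsPhys fun U => w U * Ω U) (hwm : Measurable w) {W : ℝ} (hw0 : ∀ U, 0 ≤ w U)
    (hwW : ∀ U, w U ≤ W) (hpos : 0 < ∫ U, w U * Ω U ^ 2 ∂configMeasure SU2 L) (ℓ : Edge 3 L) :
    ∫ p, w p.1 * (Ω p.1 * transferKernel su2Rep β p.1 p.2 * Ω p.2) *
        (2 - ((((p.1 ℓ * (p.2 ℓ)⁻¹ : SU2) : Matrix (Fin 2) (Fin 2) ℂ)).trace).re) ∂(configMeasure SU2 L).prod (configMeasure SU2 L) ≤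
      (2 / β) * topValue su2Rep L β * (∫ U, w U * Ω U ^ 2 ∂configMeasure SU2 L) *
        (6 + Real.log W / 2 - Real.log (uniformFloorConst L) + Real.log ((∫ U, w U * Ω U ^ 2 ∂configMeasure SU2 L)⁻¹) / 2) := by
  classical
  haveI : SecondCountableTopology SU2 := secondCountableTopology_su2
  have hβ0 : 0 < β := by linarith
  set μ2 : Measure (GaugeConfig 3 L SU2 × GaugeConfig 3 L SU2) := (configMeasure SU2 L).prod (configMeasure SU2 L) with hμ2
  set E : ℕ := Fintype.card (Edge 3 L) with hE
  set T : ℝ := topValue su2Rep L β with hT_def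
  have hT : 0 < T := topValue_su2Rep_pos L β
  set m : ℝ := ∫ U, w U * Ω U ^ 2 ∂configMeasure SU2 L with hm_def
  have hW0 : 0 < W := by
    by_contra hW
    push Not at hW
    have : ∫ U, w U * Ω U ^ 2 ∂configMeasure SU2 L ≤ 0 :=
      integral_nonpos fun U => mul_nonpos_of_nonpos_of_nonneg (by linarith [hw0 U, hwW U]) (sq_nonneg _)
    linarith
  obtain ⟨CΩ, hCΩ⟩ := hΩ.bounded
  have hCΩ0 : 0 ≤ CΩ := (abs_nonneg _).trans (hCΩ (fun _ => 1))
  have hwb : ∀ U, |w U| ≤ W := fun U => by rw [abs_of_nonneg (hw0 U)]; exact hwW U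
  -- the weighted pair weight and the single-link tilt
  set wt : GaugeConfig 3 L SU2 × GaugeConfig 3 L SU2 → ℝ :=
    fun p => w p.1 * (Ω p.1 * transferKernel su2Rep β p.1 p.2 * Ω p.2) with hwt_def
  set q : GaugeConfig 3 L SU2 × GaugeConfig 3 L SU2 → ℝ :=
    fun p => 2 - ((((p.1 ℓ * (p.2 ℓ)⁻¹ : SU2) : Matrix (Fin 2) (Fin 2) ℂ)).trace).re with hq_def
  set X : GaugeConfig 3 L SU2 × GaugeConfig 3 L SU2 → ℝ := fun p => β / 2 * q p with hX_def
  have hq0 : ∀ p, 0 ≤ q p := fun p => by rw [hq_def]; dsimp only; linarith [re_trace_le_two (p.1 ℓ * (p.2 ℓ)⁻¹)]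
  have hq4 : ∀ p, q p ≤ 4 := fun p => by rw [hq_def]; dsimp only; linarith [neg_two_le_re_trace (p.1 ℓ * (p.2 ℓ)⁻¹)]
  have hwt0 : ∀ p, 0 ≤ wt p := fun p =>
    mul_nonneg (hw0 _) (mul_nonneg (mul_nonneg (hΩnn _) (transferKernel_pos _ _ _ _).le) (hΩnn _))
  have hX0 : ∀ p, 0 ≤ X p := fun p => by rw [hX_def]; dsimp only; exact mul_nonneg (by positivity) (hq0 p)
  have hXle : ∀ p, X p ≤ 2 * β := fun p => by rw [hX_def]; dsimp only; nlinarith [hq4 p]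
  -- measurability / integrability
  have hKm : Measurable fun p : GaugeConfig 3 L SU2 × GaugeConfig 3 L SU2 => transferKernel su2Rep β p.1 p.2 :=
    measurable_transferKernel_lat β
  have hqm : Measurable q := by
    have hc : Continuous fun p : GaugeConfig 3 L SU2 × GaugeConfig 3 L SU2 => (p.1 ℓ * (p.2 ℓ)⁻¹ : SU2) :=
      ((continuous_apply ℓ).comp continuous_fst).mul ((continuous_apply ℓ).comp continuous_snd).inv
    exact (continuous_const.sub (Complex.continuous_re.comp ((continuous_subtype_val.comp hc).matrix_trace))).measurable
  have hwtm : Measurable wt :=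
    (hwm.comp measurable_fst).mul (((hΩ.measurable.comp measurable_fst).mul hKm).mul (hΩ.measurable.comp measurable_snd))
  have hXm : Measurable X := measurable_const.mul hqm
  have hKb : ∀ p : GaugeConfig 3 L SU2 × GaugeConfig 3 L SU2, |transferKernel su2Rep β p.1 p.2| ≤ Real.exp (2 * β) ^ E :=
    fun p => abs_transferKernel_le_lat hβ0.le p
  have hwtb : ∀ p, |wt p| ≤ W * (CΩ * Real.exp (2 * β) ^ E * CΩ) := fun p => by
    rw [hwt_def]; dsimp only; rw [abs_mul, abs_mul, abs_mul]
    exact mul_le_mul (hwb _) (mul_le_mul (mul_le_mul (hCΩ _) (hKb p) (abs_nonneg _) hCΩ0) (hCΩ _) (abs_nonneg _) (by positivity))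
      (by positivity) hW0.le
  have hXb : ∀ p, |X p| ≤ 2 * β := fun p => by rw [abs_of_nonneg (hX0 p)]; exact hXle p
  have hwti : Integrable wt μ2 := integrable_latProd hwtm hwtb
  have hXwti : Integrable (fun p => X p * wt p) μ2 :=
    integrable_latProd (hXm.mul hwtm) (C := 2 * β * (W * (CΩ * Real.exp (2 * β) ^ E * CΩ))) fun p => by
      rw [abs_mul]; exact mul_le_mul (hXb p) (hwtb p) (abs_nonneg _) (by positivity)
  have heXwti : Integrable (fun p => Real.exp (X p) * wt p) μ2 :=
    integrable_latProd ((Real.measurable_exp.comp hXm).mul hwtm)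
      (C := Real.exp (2 * β) * (W * (CΩ * Real.exp (2 * β) ^ E * CΩ))) fun p => by
      rw [abs_mul, abs_of_pos (Real.exp_pos _)]
      exact mul_le_mul (Real.exp_le_exp.2 (hXle p)) (hwtb p) (abs_nonneg _) (Real.exp_pos _).le
  -- total mass `∫ wt = λ₀ E[wΩ²]`
  have hwtT : ∫ p, wt p ∂μ2 = T * m := by
    have h1 : (fun p => wt p) = fun p => Ω p.1 * transferKernel su2Rep β p.1 p.2 * Ω p.2 * w p.1 := by
      funext p; rw [hwt_def]; ring
    rw [h1, hμ2, integral_pair_mul_fst_eq (L := L) β hwΩ hΩ heig]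
  have hTm : 0 < T * m := mul_pos hT hpos
  -- the tilted mass
  set M : ℝ := ∫ p, Real.exp (X p) * wt p ∂μ2 with hM_def
  obtain ⟨hHpos, hHle, hHm⟩ := latEHalf_pos_le_measurable (L := L) hβ0.le ℓ
  set H : GaugeConfig 3 L SU2 × GaugeConfig 3 L SU2 → ℝ :=
    fun p => ∏ e : Edge 3 L, Function.update (fun _ : Edge 3 L => linkW β) ℓ (linkW (β / 2)) e (p.1 e * (p.2 e)⁻¹) with hH_def
  have hWm : 0 < W * m := mul_pos hW0 hpos
  set t : ℝ := (Real.sqrt (W * m))⁻¹ with ht_def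
  have ht0 : 0 < t := inv_pos.2 (Real.sqrt_pos.2 hWm)
  have ht2 : t ^ 2 = (W * m)⁻¹ := by rw [ht_def, inv_pow, Real.sq_sqrt hWm.le]
  have hΩ2int : ∫ U, Ω U ^ 2 ∂configMeasure SU2 L = 1 := by
    rw [← hn]; unfold l2; exact integral_congr_ae (ae_of_all _ fun U => by ring)
  have hMle : M ≤ Real.exp β * (linkC (β / 2) * linkC β ^ (E - 1)) * (t * (W * m) / 2 + 1 / (2 * t)) := by
    -- pointwise: `e^X wt ≤ e^β H · w(U)Ω(U)Ω(V) ≤ e^β H · (t w²Ω(U)² + Ω(V)²/t)/2`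
    have hpt : ∀ p, Real.exp (X p) * wt p ≤
        Real.exp β * (H p * (w p.1 ^ 2 * Ω p.1 ^ 2) * (t / 2)) + Real.exp β * (H p * Ω p.2 ^ 2 * (1 / (2 * t))) := by
      intro p
      have h1 := exp_linkTilt_mul_transferKernel_le (L := L) hβ0.le ℓ p.1 p.2
      have h2 : Real.exp (X p) * wt p = (Real.exp (X p) * transferKernel su2Rep β p.1 p.2) * (w p.1 * Ω p.1 * Ω p.2) := by
        rw [hwt_def, hX_def, hq_def]; ring
      rw [h2]
      have hwΩΩ : 0 ≤ w p.1 * Ω p.1 * Ω p.2 := mul_nonneg (mul_nonneg (hw0 _) (hΩnn _)) (hΩnn _)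
      have hH0 : 0 ≤ Real.exp β * H p := mul_nonneg (Real.exp_pos _).le (hHpos p).le
      have hamgm : w p.1 * Ω p.1 * Ω p.2 ≤ (t * (w p.1 ^ 2 * Ω p.1 ^ 2) + Ω p.2 ^ 2 / t) / 2 := by
        have ht' : 0 < t := ht0
        have key : 0 ≤ (t * (w p.1 * Ω p.1) - Ω p.2) ^ 2 := sq_nonneg _
        have : w p.1 * Ω p.1 * Ω p.2 * (2 * t) ≤ t * (t * (w p.1 ^ 2 * Ω p.1 ^ 2)) + Ω p.2 ^ 2 := by nlinarith
        rw [le_div_iff₀ (by norm_num : (0:ℝ) < 2)]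
        have e1 : (t * (w p.1 ^ 2 * Ω p.1 ^ 2) + Ω p.2 ^ 2 / t) = (t * (t * (w p.1 ^ 2 * Ω p.1 ^ 2)) + Ω p.2 ^ 2) / t := by
          field_simp
        rw [e1, le_div_iff₀ ht']
        nlinarith
      calc Real.exp (X p) * transferKernel su2Rep β p.1 p.2 * (w p.1 * Ω p.1 * Ω p.2)
          ≤ Real.exp β * H p * (w p.1 * Ω p.1 * Ω p.2) := mul_le_mul_of_nonneg_right h1 hwΩΩ
        _ ≤ Real.exp β * H p * ((t * (w p.1 ^ 2 * Ω p.1 ^ 2) + Ω p.2 ^ 2 / t) / 2) := mul_le_mul_of_nonneg_left hamgm hH0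
        _ = Real.exp β * (H p * (w p.1 ^ 2 * Ω p.1 ^ 2) * (t / 2)) + Real.exp β * (H p * Ω p.2 ^ 2 * (1 / (2 * t))) := by ring
    -- integrals of the two majorants
    have hw2m : Measurable fun U : GaugeConfig 3 L SU2 => w U ^ 2 * Ω U ^ 2 := (hwm.pow_const 2).mul (hΩ.measurable.pow_const 2)
    have hw2b : ∀ U, |w U ^ 2 * Ω U ^ 2| ≤ W ^ 2 * (CΩ * CΩ) := fun U => by
      rw [abs_mul, abs_pow, abs_pow, abs_of_nonneg (hw0 U)]
      exact mul_le_mul (pow_le_pow_left₀ (hw0 U) (hwW U) 2)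
        (by rw [sq]; exact mul_le_mul (hCΩ U) (hCΩ U) (abs_nonneg _) hCΩ0) (sq_nonneg _) (by positivity)
    have hΩ2m : Measurable fun U : GaugeConfig 3 L SU2 => Ω U ^ 2 := hΩ.measurable.pow_const 2
    have hΩ2b : ∀ U, |Ω U ^ 2| ≤ CΩ * CΩ := fun U => by
      rw [abs_pow, sq]; exact mul_le_mul (hCΩ U) (hCΩ U) (abs_nonneg _) hCΩ0
    have hi1 : Integrable (fun p : GaugeConfig 3 L SU2 × GaugeConfig 3 L SU2 => H p * (w p.1 ^ 2 * Ω p.1 ^ 2)) μ2 :=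
      integrable_latProd (hHm.mul (hw2m.comp measurable_fst)) (C := Real.exp (2 * β) ^ E * (W ^ 2 * (CΩ * CΩ))) fun p => by
        rw [abs_mul, abs_of_pos (hHpos p)]; exact mul_le_mul (hHle p) (hw2b _) (abs_nonneg _) (by positivity)
    have hi2 : Integrable (fun p : GaugeConfig 3 L SU2 × GaugeConfig 3 L SU2 => H p * Ω p.2 ^ 2) μ2 :=
      integrable_latProd (hHm.mul (hΩ2m.comp measurable_snd)) (C := Real.exp (2 * β) ^ E * (CΩ * CΩ)) fun p => by
        rw [abs_mul, abs_of_pos (hHpos p)]; exact mul_le_mul (hHle p) (hΩ2b _) (abs_nonneg _) (by positivity)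
    -- row identity for `H · Φ(U)` and column identity for `H · Φ(V)` (Fubini)
    have hrow : ∫ p, H p * (w p.1 ^ 2 * Ω p.1 ^ 2) ∂μ2 = (linkC (β / 2) * linkC β ^ (E - 1)) * ∫ U, w U ^ 2 * Ω U ^ 2 ∂configMeasure SU2 L := by
      rw [hμ2, integral_prod _ hi1]
      have inner : ∀ U : GaugeConfig 3 L SU2, ∫ V, H (U, V) * (w U ^ 2 * Ω U ^ 2) ∂configMeasure SU2 L =
          (linkC (β / 2) * linkC β ^ (E - 1)) * (w U ^ 2 * Ω U ^ 2) := fun U => by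
        rw [integral_mul_const, hH_def]; dsimp only; rw [integral_latEHalf_snd]
      simp only [inner]
      rw [integral_const_mul]
    have hcol : ∫ p, H p * Ω p.2 ^ 2 ∂μ2 = (linkC (β / 2) * linkC β ^ (E - 1)) * ∫ V, Ω V ^ 2 ∂configMeasure SU2 L := by
      rw [hμ2, integral_prod_symm _ hi2]
      have inner : ∀ V : GaugeConfig 3 L SU2, ∫ U, H (U, V) * Ω V ^ 2 ∂configMeasure SU2 L =
          (linkC (β / 2) * linkC β ^ (E - 1)) * Ω V ^ 2 := fun V => by
        rw [integral_mul_const, hH_def]; dsimp only; rw [integral_latEHalf_fst]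
      simp only [inner]
      rw [integral_const_mul]
    have hw2le : ∫ U, w U ^ 2 * Ω U ^ 2 ∂configMeasure SU2 L ≤ W * m := by
      rw [hm_def, ← integral_const_mul]
      refine integral_mono_of_nonneg (ae_of_all _ fun U => mul_nonneg (sq_nonneg _) (sq_nonneg _))
        ((integrable_of_measurable_abs_le _ (show Measurable (fun U => w U * Ω U ^ 2) from hwm.mul hΩ2m) (C := W * (CΩ * CΩ))
          fun U => by rw [abs_mul]; exact mul_le_mul (hwb U) (hΩ2b U) (abs_nonneg _) hW0.le).const_mul W)
        (ae_of_all _ fun U => ?_)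
      have : w U ^ 2 ≤ W * w U := by rw [sq]; exact mul_le_mul_of_nonneg_right (hwW U) (hw0 U)
      nlinarith [sq_nonneg (Ω U)]
    have hrhs_int : Integrable (fun p : GaugeConfig 3 L SU2 × GaugeConfig 3 L SU2 =>
        Real.exp β * (H p * (w p.1 ^ 2 * Ω p.1 ^ 2) * (t / 2)) + Real.exp β * (H p * Ω p.2 ^ 2 * (1 / (2 * t)))) μ2 :=
      ((hi1.mul_const _).const_mul _).add ((hi2.mul_const _).const_mul _)
    have hmono := integral_mono heXwti hrhs_int hpt
    have hcc : 0 ≤ Real.exp β * (linkC (β / 2) * linkC β ^ (E - 1)) :=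
      mul_nonneg (Real.exp_pos _).le (mul_nonneg (linkC_pos (by positivity)).le (pow_nonneg (linkC_pos hβ0.le).le _))
    calc M ≤ ∫ p, (Real.exp β * (H p * (w p.1 ^ 2 * Ω p.1 ^ 2) * (t / 2)) + Real.exp β * (H p * Ω p.2 ^ 2 * (1 / (2 * t)))) ∂μ2 := hmono
      _ = Real.exp β * (linkC (β / 2) * linkC β ^ (E - 1)) *
            ((∫ U, w U ^ 2 * Ω U ^ 2 ∂configMeasure SU2 L) * (t / 2) + 1 / (2 * t)) := by
          rw [integral_add ((hi1.mul_const _).const_mul _) ((hi2.mul_const _).const_mul _), integral_const_mul, integral_const_mul,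
            integral_mul_const, integral_mul_const, hrow, hcol, hΩ2int]
          ring
      _ ≤ Real.exp β * (linkC (β / 2) * linkC β ^ (E - 1)) * (t * (W * m) / 2 + 1 / (2 * t)) := by
          refine mul_le_mul_of_nonneg_left ?_ hcc
          have : (∫ U, w U ^ 2 * Ω U ^ 2 ∂configMeasure SU2 L) * (t / 2) ≤ W * m * (t / 2) :=
            mul_le_mul_of_nonneg_right hw2le (by positivity)
          linarith
  -- `t (W m)/2 + 1/(2t) = (W m)^{1/2}` at `t = (W m)^{-1/2}`
  have hbr : t * (W * m) / 2 + 1 / (2 * t) = t⁻¹ := by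
    have h1 : t * (W * m) = t⁻¹ := by
      have : t * t * (W * m) = 1 := by rw [← sq, ht2, inv_mul_cancel₀ hWm.ne']
      field_simp
      linarith [this]
    rw [h1]; field_simp; ring
  rw [hbr] at hMle
  have hMpos : 0 < M := by
    have hge : ∫ p, wt p ∂μ2 ≤ M := integral_mono hwti heXwti fun p => by
      have : 1 ≤ Real.exp (X p) := Real.one_le_exp (hX0 p)
      nlinarith [hwt0 p]
    linarith
  -- Jensen
  have hJ := integral_mul_le_mul_log μ2 hwt0 hTm hwtT hXwti heXwti hwti rfl hMpos
  -- the log budget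
  have hu : 0 < uniformFloorConst L := uniformFloorConst_pos
  have hfloor : uniformFloorConst L * latCE L β ≤ T := by
    have h := levelValue_zero_ge_uniform (L := L) hβ; rw [levelValue_zero] at h; exact h
  have hcβ : 0 < linkC β := linkC_pos hβ0.le
  have hch : 0 < linkC (β / 2) := linkC_pos (by positivity)
  have hE1 : 1 ≤ E := by rw [hE]; exact Fintype.card_pos
  have hlog : Real.log (M / (T * m)) ≤ 6 + Real.log W / 2 - Real.log (uniformFloorConst L) + Real.log m⁻¹ / 2 := by
    have hnum0 : 0 < Real.exp β * (linkC (β / 2) * linkC β ^ (E - 1)) * t⁻¹ := by positivity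
    have h1 : Real.log (M / (T * m)) ≤ Real.log (Real.exp β * (linkC (β / 2) * linkC β ^ (E - 1)) * t⁻¹ / (T * m)) :=
      Real.log_le_log (div_pos hMpos hTm) (div_le_div_of_nonneg_right hMle hTm.le)
    refine h1.trans ?_
    rw [Real.log_div hnum0.ne' hTm.ne', Real.log_mul (by positivity) (by positivity), Real.log_mul (by positivity) (by positivity),
      Real.log_exp, Real.log_mul hch.ne' (by positivity), Real.log_pow, Real.log_inv, Real.log_mul hT.ne' hpos.ne']
    -- `log t = −½ log (W m)`
    have hlogt : Real.log t = -(1 / 2) * (Real.log W + Real.log m) := by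
      rw [ht_def, Real.log_inv, Real.log_sqrt hWm.le, Real.log_mul hW0.ne' hpos.ne']; ring
    -- `log T ≥ log c_L + E log c_β`
    have hTlog : Real.log (uniformFloorConst L) + E * Real.log (linkC β) ≤ Real.log T := by
      have h := (Real.log_le_log_iff (mul_pos hu (latCE_pos hβ0.le)) hT).2 hfloor
      rw [Real.log_mul hu.ne' (latCE_pos hβ0.le).ne'] at h
      unfold latCE at h; rw [← hE, Real.log_pow] at h
      exact h
    have hratio := log_linkC_sub_log_linkC_half_ge hβ
    have hEsub : ((E - 1 : ℕ) : ℝ) = (E : ℝ) - 1 := by rw [Nat.cast_sub hE1]; norm_num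
    have hlogs : Real.log (Real.sqrt (W * m)) = (Real.log W + Real.log m) / 2 := by
      rw [Real.log_sqrt hWm.le, Real.log_mul hW0.ne' hpos.ne']
    have hminv : Real.log m⁻¹ = -Real.log m := Real.log_inv m
    rw [hEsub]
    have hprod : ((E : ℝ) - 1) * Real.log (linkC β) = E * Real.log (linkC β) - Real.log (linkC β) := by ring
    rw [hprod]
    linarith
  -- conclude
  have hconv : (fun p : GaugeConfig 3 L SU2 × GaugeConfig 3 L SU2 => w p.1 * (Ω p.1 * transferKernel su2Rep β p.1 p.2 * Ω p.2) *
      (2 - ((((p.1 ℓ * (p.2 ℓ)⁻¹ : SU2) : Matrix (Fin 2) (Fin 2) ℂ)).trace).re)) = fun p => (2 / β) * (X p * wt p) := by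
    funext p; rw [hX_def, hwt_def, hq_def]; dsimp only; field_simp
  rw [hconv, integral_const_mul]
  have h2β : 0 ≤ 2 / β := by positivity
  calc 2 / β * ∫ p, X p * wt p ∂μ2 ≤ 2 / β * (T * m * Real.log (M / (T * m))) := mul_le_mul_of_nonneg_left hJ h2β
    _ ≤ 2 / β * (T * m * (6 + Real.log W / 2 - Real.log (uniformFloorConst L) + Real.log m⁻¹ / 2)) :=
        mul_le_mul_of_nonneg_left (mul_le_mul_of_nonneg_left hlog hTm.le) h2β
    _ = _ := by ring

end Summit.QuantumFields.YangMills.Theorems.TransportFieldFano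

end
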